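import Summits.Langlands.Statement
import Literature.NumberTheory.Automorphic.IsAutomorphicAE
import Literature.NumberTheory.GaloisRepresentations.FramedRepBaseChange
import HarnessLib

/-!
# `ReciprocityUpToIrreducibility` (item stmt-Langlands-14328), line `Sketch`: the stub B_w
(weak automorphy) against the accepted conjecture texts

The line's stub `stub_weakAutomorphy` (B_w) is the almost-everywhere form of
Fontaine–Mazur–Langlands for `GL_n` over every number field, for the summit's PINNED `p`-adic Hodge
datum (`Literature.NumberTheory.PAdicHodge.fontainePstAdicCompletion v ℓ hv`): every irreducible
`ρ : Γ_K → GL_n(ℚ̄_ℓ)` unramified almost everywhere and pinned-de Rham above `ℓ` is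
Satake–Frobenius compatible at almost all places with some L-algebraic cuspidal `π` of
`GL_n(𝔸_K)`.  It is an OPEN PROBLEM (Fontaine–Mazur 1995, Conj. 1, with Langlands; Buzzard–Gee
2014, Conj. 3.2.2) and nothing here proves it.  This file certifies, sorry-free, where B_w sits:

* `weakAutomorphy_of_galoisToAutomorphic` — B_w at `(K, n, hcpt)` is VERBATIM the summit's
  direction (B) `Summit.Langlands.GaloisToAutomorphic n 𝓡 hcpt` (any reciprocity datum `𝓡`) with
  the local–global clause of `Corresponds` dropped (`IsGeometricFramed 𝓡 ρ` does not depend on `𝓡`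
  and is definitionally the pinned hypothesis of B_w);
* `stub_weakAutomorphy_of_langlands` — hence the registered signature of the stub, verbatim,
  follows from the summit `Langlands` (B_w is a necessary condition of the summit and of the item);
* `weakAutomorphy_of_fontaineMazurLanglandsGLn` — the accepted Literature text lang.S03
  `FontaineMazurLanglandsGLn 𝔅 n`, instantiated at the pinned family
  `𝔅 K ℓ v hv := ⟨(fontainePstAdicCompletion v ℓ hv).algebra, (fontainePstAdicCompletion v ℓ hv).𝔅⟩`
  (this instantiation type-checks: same universes, same `Σ'` packaging as `DeRhamData`), has
  VERBATIM the conclusion of B_w (`IsAutomorphicAE ι hcpt ρ` unfolds to it; same L-normalisation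
  `arithFrobPolyOfSatake ι q_v 1 α`, same `IsLAlgebraic`, same `∀ hcpt`), but its geometricity
  hypothesis is phrased for the `ℚ_ℓ`-restriction of ONE GLOBAL finite model `rE` of `ρ`
  (`HasQlModel ρ E rE`, `(restrictScalarsQl E rE).IsGeometric (𝔅 K ℓ)`), whereas B_w's is phrased
  place by place through LOCAL finite models of `ρ|_{Γ_{K_v}}` (`IsDeRhamFramed`);
* `isUnramifiedAE_restrictScalarsQl_of_hasQlModel` — the unramified half of that hypothesis gap is
  closed here for every global model (change of frame and of coefficients preserve unramifiedness);
  the de Rham half — independence of `𝔅`-admissibility from the finite model, i.e.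
  `(fontainePstAdicCompletion v ℓ hv).IsDeRhamFramed (ρ.toLocal v) →
   ((restrictScalarsQl E rE).toLocal v).IsDeRham (fontainePstAdicCompletion v ℓ hv).𝔅` for a global
  model `(E, rE)` of `ρ` (Fontaine 1994, Exp. III Thm. 1.5.2: `B`-admissible representations are
  stable under sub-objects and direct sums, plus extension of scalars `E ⊆ E'`) — is NOT in the tree
  and is the only remaining difference between B_w and lang.S03-for-the-pinned-datum.

No new definitions; axioms `propext`, `Classical.choice`, `Quot.sound`.
-/

noncomputable section

set_option linter.dupNamespace false -- project-wide option (lakefile weak.linter.dupNamespace); `Summit.Langlands.Langlands` is the mandated namespace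

open scoped NumberField Classical Polynomial
open Filter IsDedekindDomain Polynomial
open Literature.NumberTheory.Automorphic Literature.NumberTheory.GaloisRepresentations
open Summit.Langlands

namespace Summit.Langlands.Langlands.Theorems.ReciprocityUpToIrreducibility

variable {K : Type} [Field K] [NumberField K] {n : ℕ} {hcpt : isCompact_glFiniteIntegralLevel n K}
  {ℓ : ℕ} [Fact ℓ.Prime]

/-! ## B_w is direction (B) of the summit minus local–global compatibility -/

/-- **B_w from the summit's direction (B).**  If `GaloisToAutomorphic n 𝓡 hcpt` holds for some
reciprocity datum `𝓡` of `K` (Fontaine–Mazur–Langlands with local–global compatibility at every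
finite place), then every irreducible `ρ : Γ_K → GL_n(ℚ̄_ℓ)` which is unramified almost everywhere
and de Rham above `ℓ` for the pinned datum `fontainePstAdicCompletion v ℓ hv` is Satake–Frobenius
compatible at almost all places with some L-algebraic cuspidal `π` of `GL_n(𝔸_K)`: the geometric
hypothesis `IsGeometricFramed 𝓡 ρ` of (B) is definitionally the pinned one (`ReciprocityData.pst`
ignores `𝓡`), and the conclusion keeps the first conjunct of `Corresponds 𝓡 ι π ρ`.
[cite: FontaineMazurGeometric1995, Conj. 1] [cite: BuzzardGeeLMS2014, Conj. 3.2.2] -/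
theorem weakAutomorphy_of_galoisToAutomorphic (𝓡 : ReciprocityData K)
    (h : GaloisToAutomorphic n 𝓡 hcpt) (ι : PadicAlgCl ℓ ≃+* ℂ)
    (ρ : FramedGaloisRep K (PadicAlgCl ℓ) n) (hirr : ρ.toGaloisRep.IsIrreducible)
    (hgeo : (∀ᶠ v : HeightOneSpectrum (𝓞 K) in cofinite, ρ.IsUnramifiedAt v) ∧
      ∀ (v : HeightOneSpectrum (𝓞 K)) (hv : ((ℓ : ℕ) : 𝓞 K) ∈ v.asIdeal),
        (Literature.NumberTheory.PAdicHodge.fontainePstAdicCompletion v ℓ hv).IsDeRhamFramed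
          (ρ.toLocal v)) :
    ∃ π : CuspidalAutomorphicRepData n K hcpt, π.1.IsLAlgebraic ∧
      ∀ᶠ v : HeightOneSpectrum (𝓞 K) in cofinite, SatakeFrobCompatibleAt ι π.1 ρ v := by
  obtain ⟨π, hL, hcorr⟩ := h ℓ ι ρ hirr hgeo
  exact ⟨π, hL, hcorr.1⟩

/-- **The registered stub B_w (`stub_weakAutomorphy` of line `Sketch`), verbatim, from the summit
`Langlands`**: the summit supplies, for every number field, a reciprocity datum `𝓡` with
`GaloisToAutomorphic n 𝓡 hcpt` for every `n ≥ 1` and every level witness `hcpt`, and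
`weakAutomorphy_of_galoisToAutomorphic` drops the local–global clause.  So B_w is a NECESSARY
condition of the summit (and of the item `ReciprocityUpToIrreducibility`, whose second conjunct is
the same `GaloisToAutomorphic`); it remains open (Fontaine–Mazur–Langlands for all `n` over all
number fields). [cite: FontaineMazurGeometric1995, Conj. 1] [cite: BuzzardGeeLMS2014, Conj. 3.2.2] -/
theorem stub_weakAutomorphy_of_langlands : _root_.Langlands →
    ∀ (K : Type) [Field K] [NumberField K] (n : ℕ) (hcpt : isCompact_glFiniteIntegralLevel n K),
      0 < n → ∀ (ℓ : ℕ) [Fact ℓ.Prime] (ι : PadicAlgCl ℓ ≃+* ℂ) (ρ : FramedGaloisRep K (PadicAlgCl ℓ) n),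
        ρ.toGaloisRep.IsIrreducible →
        ((∀ᶠ v : HeightOneSpectrum (𝓞 K) in cofinite, ρ.IsUnramifiedAt v) ∧
          ∀ (v : HeightOneSpectrum (𝓞 K)) (hv : ((ℓ : ℕ) : 𝓞 K) ∈ v.asIdeal),
            (Literature.NumberTheory.PAdicHodge.fontainePstAdicCompletion v ℓ hv).IsDeRhamFramed
              (ρ.toLocal v)) →
          ∃ π : CuspidalAutomorphicRepData n K hcpt, π.1.IsLAlgebraic ∧
            ∀ᶠ v : HeightOneSpectrum (𝓞 K) in cofinite, SatakeFrobCompatibleAt ι π.1 ρ v := by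
  intro h K _ _ n hcpt hn ℓ _ ι ρ hirr hgeo
  -- (buildfix 2026-08-20, proof-only: the summit is now `Nonempty (ReciprocityData K) ∧ ∀ 𝓡, …`)
  obtain ⟨⟨𝓡⟩, h𝓡⟩ := h K
  exact weakAutomorphy_of_galoisToAutomorphic 𝓡 (h𝓡 𝓡 n hn hcpt).2 ι ρ hirr hgeo

/-! ## B_w against lang.S03 (`FontaineMazurLanglandsGLn`) for the pinned period-ring data -/

/-- **lang.S03 for the pinned datum gives the conclusion of B_w verbatim.**  Instantiate the
accepted `FontaineMazurLanglandsGLn 𝔅 n` at the pinned family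
`𝔅 K ℓ v hv := ⟨(fontainePstAdicCompletion v ℓ hv).algebra, (fontainePstAdicCompletion v ℓ hv).𝔅⟩`
(Fontaine's `B_dR(K_v)` with the canonical `ℚ_ℓ`-structure, as pinned by the summit).  For an
irreducible `ρ : Γ_K → GL_n(ℚ̄_ℓ)` with a global finite model `rE` over `E` (`HasQlModel ρ E rE`;
such a model always exists, `exists_hasQlModel_holds`) whose `ℚ_ℓ`-restriction is geometric for
this family, there is an L-algebraic cuspidal `π` of `GL_n(𝔸_K)` Satake–Frobenius compatible with
`ρ` at almost all places — the conclusion of B_w, definitionally (`IsAutomorphicAE ι hcpt ρ`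
unfolds to it: same L-normalisation `arithFrobPolyOfSatake ι q_v 1 α`).  What separates this from
B_w is only the hypothesis side: B_w assumes de Rham-ness of LOCAL finite models of each
`ρ|_{Γ_{K_v}}`, `v ∣ ℓ` (`IsDeRhamFramed`), lang.S03 that of the restriction of ONE global model;
their equivalence (Fontaine 1994, Exp. III Thm. 1.5.2 with extension of scalars) is not in the tree.
[cite: FontaineMazurGeometric1995, Conj. 1] [cite: BuzzardGeeLMS2014, Conj. 3.2.2] -/
theorem weakAutomorphy_of_fontaineMazurLanglandsGLn
    (h : FontaineMazurLanglandsGLn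
      (fun (K : Type) [Field K] [NumberField K] (ℓ : ℕ) [Fact ℓ.Prime]
          (v : HeightOneSpectrum (𝓞 K)) (hv : ((ℓ : ℕ) : 𝓞 K) ∈ v.asIdeal) =>
        ⟨(Literature.NumberTheory.PAdicHodge.fontainePstAdicCompletion v ℓ hv).algebra,
          (Literature.NumberTheory.PAdicHodge.fontainePstAdicCompletion v ℓ hv).𝔅⟩) n)
    (hcpt : isCompact_glFiniteIntegralLevel n K) (ι : PadicAlgCl ℓ ≃+* ℂ)
    (ρ : FramedGaloisRep K (PadicAlgCl ℓ) n) (hirr : ρ.toGaloisRep.IsIrreducible)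
    (E : IntermediateField ℚ_[ℓ] (PadicAlgCl ℓ)) [FiniteDimensional ℚ_[ℓ] E]
    (rE : FramedGaloisRep K E n) (hmodel : HasQlModel ρ E rE)
    (hgeo : (restrictScalarsQl E rE).IsGeometric
      fun (v : HeightOneSpectrum (𝓞 K)) (hv : ((ℓ : ℕ) : 𝓞 K) ∈ v.asIdeal) =>
        ⟨(Literature.NumberTheory.PAdicHodge.fontainePstAdicCompletion v ℓ hv).algebra,
          (Literature.NumberTheory.PAdicHodge.fontainePstAdicCompletion v ℓ hv).𝔅⟩) :
    ∃ π : CuspidalAutomorphicRepData n K hcpt, π.1.IsLAlgebraic ∧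
      ∀ᶠ v : HeightOneSpectrum (𝓞 K) in cofinite, SatakeFrobCompatibleAt ι π.1 ρ v :=
  h K hcpt ℓ ι E rE ρ hmodel hirr hgeo

omit [NumberField K] in
/-- Unramifiedness at `v` of the `ℚ_ℓ`-linear representation underlying a model `rE` over
`E ⊆ ℚ̄_ℓ` is unramifiedness of `rE` (same maps; the standard representation is faithful).
Serre 1968, Ch. I §2.1. [folklore] -/
theorem isUnramifiedAt_restrictScalarsQl_iff (E : IntermediateField ℚ_[ℓ] (PadicAlgCl ℓ))
    (rE : FramedGaloisRep K E n) (v : HeightOneSpectrum (𝓞 K)) :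
    (restrictScalarsQl E rE).IsUnramifiedAt v ↔ rE.IsUnramifiedAt v := by
  rw [← FramedGaloisRep.isUnramifiedAt_toGaloisRep_iff]
  refine forall₂_congr fun 𝔓 _ => forall₂_congr fun σ _ => ?_
  constructor
  · intro h
    refine LinearMap.ext fun x => ?_
    simpa using LinearMap.congr_fun h x
  · intro h
    refine LinearMap.ext fun x => ?_
    simpa using LinearMap.congr_fun h x

omit [NumberField K] in
/-- **The unramified half of the hypothesis gap between B_w and lang.S03, closed**: if `ρ` is
unramified at almost all places then so is the `ℚ_ℓ`-restriction of ANY model `rE` of `ρ` over a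
subfield `E ⊆ ℚ̄_ℓ` (`GaloisRep.IsUnramifiedAE`, the first clause of `GaloisRep.IsGeometric`):
unramifiedness is invariant under change of frame (`FramedGaloisRep.isUnramifiedAt_conj_iff`) and
under the injective change of coefficients `E ⊆ ℚ̄_ℓ`
(`FramedGaloisRep.isUnramifiedAt_baseChange_iff`).  Serre 1968, Ch. I §2.1. [folklore] -/
theorem isUnramifiedAE_restrictScalarsQl_of_hasQlModel {ρ : FramedGaloisRep K (PadicAlgCl ℓ) n}
    {E : IntermediateField ℚ_[ℓ] (PadicAlgCl ℓ)} {rE : FramedGaloisRep K E n}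
    (hmodel : HasQlModel ρ E rE)
    (hur : ∀ᶠ v : HeightOneSpectrum (𝓞 K) in cofinite, ρ.IsUnramifiedAt v) :
    (restrictScalarsQl E rE).IsUnramifiedAE := by
  obtain ⟨P, rfl⟩ := hmodel
  have hur' : ∀ᶠ v : HeightOneSpectrum (𝓞 K) in cofinite, rE.IsUnramifiedAt v :=
    hur.mono fun v hv =>
      (FramedGaloisRep.isUnramifiedAt_baseChange_iff _ _
          (algebraMap E (PadicAlgCl ℓ)).injective v rE).1
        ((FramedGaloisRep.isUnramifiedAt_conj_iff v P _).1 hv)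
  refine ⟨{v | ¬ rE.IsUnramifiedAt v}, Filter.eventually_cofinite.1 hur', fun v hv => ?_⟩
  exact (isUnramifiedAt_restrictScalarsQl_iff E rE v).2 (by simpa using hv)

end Summit.Langlands.Langlands.Theorems.ReciprocityUpToIrreducibility

end
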